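import Literature.AlgebraicGeometry.Motives.EllAdicTowerAbComparison
import Literature.AlgebraicGeometry.Motives.EllAdicBockstein
import Literature.AlgebraicGeometry.Motives.EllAdicCohomologyFunctorOver
import HarnessLib

/-!
# Finiteness of the `R`-linear `ℓ`-adic cohomology from Milne VI Cor. 2.8 alone:
# `lim_m Hⁱ(Y_ét, ℤ/ℓᵐ)` is a finitely generated `ℤ_ℓ`-module and `Hⁱ((X_{k̄})_ét, ℚ_ℓ)` is
# finite-dimensional (axiom (A) of a Weil cohomology for `ellAdicCohomologyFunctor`); and
# `Hⁱ((X_{k̄})_ét, ℚ_ℓ) = 0` for `i > 2 dim X` from Milne VI Thm. 1.1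

The `ℓ`-adic theory built `R`-linearly in this tree — `etaleEllAdicTowerCohomology Y ℓ i =
lim_m Hⁱ(Y_ét, ℤ/ℓᵐ)` (`LinearCohomologyEllAdicTower.lean`), `etaleEllAdicRat ℓ Y i =
ℚ_ℓ ⊗_{ℤ_ℓ} lim` (`EllAdicTowerRational.lean`) and the functor
`ellAdicCohomologyFunctor k ℓ i : X ↦ Hⁱ((X_{k̄})_ét, ℚ_ℓ)` of the shape of `PreWeilCohomology.H`
(`EllAdicCohomologyFunctorOver.lean`) — satisfies the finiteness axiom (A) of a Weil cohomology
(`WeilCohomology.finite_obj`: "each `Hⁱ(X)` is a finite-dimensional `K`-vector space"; Deligne,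
Weil I (1.3): "Les `Hⁱ(X, ℚ_ℓ)` sont des espaces vectoriels de dimension finie sur `ℚ_ℓ`, nuls pour
`i > 2 dim(X)`", p. 274) as a
consequence of **one** named fact of the tree, Milne VI Cor. 2.8
`finite_etaleCohomology_of_isProper` (finiteness of `Hⁱ(Y_ét, M)` for `Y` proper over a separably
closed field and `M` finite), taken here as the hypothesis `h₂`:

* `module_finite_towerLim_etaleCohomologyZModPowMap` — Milne V Lemma 1.11 in instance form: if
  all `Hⁱ(Y_ét, ℤ/ℓᵐ)` are finite, `towerLim (etaleCohomologyZModPowMap Y ℓ i)` is finitely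
  generated for its canonical `ℤ_ℓ`-structure (the tree's `towerLim.module_finite_of_bockstein`
  with the Bockstein data of `EllAdicBockstein.lean`; that file's
  `module_finite_towerLim_etaleCohomology` states it with an `∃` over module structures);
* `module_finite_etaleEllAdicTowerCohomology_of_finite`, `module_finite_etaleEllAdicRat_of_finite`
  — transported to the `R`-linear tower along the `ℤ_ℓ`-linear tower isomorphism
  `etaleEllAdicTowerCohomologyLinearEquiv` (`EllAdicTowerAbComparison.lean`) and base-changed to
  `ℚ_ℓ`;
* `module_finite_etaleEllAdicTowerCohomology_of_fact`, `module_finite_etaleEllAdicRat_of_fact` —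
  for `Y` proper over a separably closed field, from `h₂`;
* `module_finite_ellAdicCohomologyFunctor_obj_of_fact`,
  `module_finite_ellAdicCohomologyFunctor_obj_of_isSmoothProjective` — **axiom (A) for
  `ellAdicCohomologyFunctor k ℓ i` on proper, in particular on smooth projective, `k`-schemes**
  (the geometric fibre `X_{k̄} → Spec k̄` is proper by base change; `k̄` is separably closed).

* `subsingleton_ellAdicCohomologyFunctor_obj_of_cd` — the companion axiom **`Hⁱ(X) = 0` for
  `i > 2 dim X`** (`WeilCohomology.subsingleton_obj`) for `ellAdicCohomologyFunctor k ℓ i`, from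
  Milne VI Thm. 1.1 (`cd_ℓ ≤ 2 dim` over a separably closed field) taken as the hypothesis `h₁` in
  the vendored form of `EllAdicComparison.lean` (levels vanish, hence `lim`, hence `ℚ_ℓ ⊗ lim`).

No pro-étale comparison (Bhatt–Scholze Prop. 5.6.2, `ellAdicCohomology_limOneSequence`) is
needed for either statement: the `R`-linear tower is the `lim` of the étale levels by
construction (contrast `subsingleton_geometricEllAdicCohomology_of_lt_of_cd_of_comparison` for
Mathlib's pro-étale groups, where a `lim¹` term intervenes).

## References

* P. Deligne, *La conjecture de Weil. I*, Publ. Math. IHÉS 43 (1974), (1.3). [Deligne1974]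
* J. S. Milne, *Étale cohomology*, Princeton (reissue 2025; held copy): V Lemma 1.11 (p. 177),
  VI Thm. 1.1 (p. 234), VI Cor. 2.8 (p. 238). [Milne2025]
-/

open CategoryTheory CategoryTheory.Limits Opposite

universe u

noncomputable section

namespace Literature.AlgebraicGeometry.Motives

open _root_.AlgebraicGeometry

section Tower

variable (Y : Scheme.{u}) (ℓ : ℕ) [hℓ : Fact ℓ.Prime] (i : ℕ)

/-- **Milne V Lemma 1.11 for `(ℤ/ℓᵐ)_m`, canonical module structure**: if all `Hⁱ(Y_ét, ℤ/ℓᵐ)`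
are finite, `towerLim (etaleCohomologyZModPowMap Y ℓ i)` with its canonical `ℤ_ℓ`-module
structure (`towerLim.instModulePadicInt`, under the torsion `Fact`) is finitely generated — the
instance form of `module_finite_towerLim_etaleCohomology` (`EllAdicBockstein.lean`, whose `∃`
hides the module structure), by the same Bockstein/König argument.
[cite: Milne2025, V Lemma 1.11] -/
theorem module_finite_towerLim_etaleCohomologyZModPowMap
    [Fact (∀ m (a : etaleCohomologyZModPow Y ℓ i m), ℓ ^ m • a = 0)]
    (hfin : ∀ m, Finite (etaleCohomologyZModPow Y ℓ i m)) :
    Module.Finite ℤ_[ℓ] (towerLim (etaleCohomologyZModPowMap Y ℓ i)) := by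
  haveI := hfin
  exact towerLim.module_finite_of_bockstein (etaleCohomologyZModPowMap Y ℓ i) ℓ
    (etaleCohomologyZModPowMul Y ℓ i) (etaleCohomologyZModPowMap_mul Y ℓ i)
    (etaleCohomologyZModPowMul_map Y ℓ i) (exists_etaleCohomologyZModPowMul_eq Y ℓ i)

/-- **`lim_m Hⁱ(Y_ét, ℤ/ℓᵐ)` (the `R`-linear tower, with cup product) is a finitely generated
`ℤ_ℓ`-module as soon as all `Hⁱ(Y_ét, ℤ/ℓᵐ)` are finite** (Milne V Lemma 1.11, transported along
the `ℤ_ℓ`-linear tower isomorphism `etaleEllAdicTowerCohomologyLinearEquiv`).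
[cite: Milne2025, V Lemma 1.11] -/
theorem module_finite_etaleEllAdicTowerCohomology_of_finite
    (hfin : ∀ m, Finite (etaleCohomologyZModPow Y ℓ i m)) :
    Module.Finite ℤ_[ℓ] (etaleEllAdicTowerCohomology Y ℓ i) := by
  haveI : Fact (∀ m (a : etaleCohomologyZModPow Y ℓ i m), ℓ ^ m • a = 0) :=
    ⟨pow_smul_etaleCohomologyZModPow Y ℓ i⟩
  haveI := module_finite_towerLim_etaleCohomologyZModPowMap Y ℓ i hfin
  exact Module.Finite.equiv (etaleEllAdicTowerCohomologyLinearEquiv Y ℓ i).symm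

/-- **`Hⁱ(Y_ét, ℚ_ℓ) = ℚ_ℓ ⊗ lim_m Hⁱ(Y_ét, ℤ/ℓᵐ)` is finite-dimensional as soon as all
`Hⁱ(Y_ét, ℤ/ℓᵐ)` are finite.** [cite: Milne2025, V Lemma 1.11] -/
theorem module_finite_etaleEllAdicRat_of_finite
    (hfin : ∀ m, Finite (etaleCohomologyZModPow Y ℓ i m)) :
    Module.Finite ℚ_[ℓ] (etaleEllAdicRat ℓ Y i) := by
  haveI := module_finite_etaleEllAdicTowerCohomology_of_finite Y ℓ i hfin
  infer_instance

/-- **Finiteness for proper `Y` over a separably closed field, from Milne VI Cor. 2.8**: the named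
fact `finite_etaleCohomology_of_isProper` (taken as a hypothesis) gives the finiteness of all
levels, hence `lim_m Hⁱ(Y_ét, ℤ/ℓᵐ)` is finitely generated over `ℤ_ℓ` and `Hⁱ(Y_ét, ℚ_ℓ)` is
finite-dimensional — with no need for the pro-étale comparison (Bhatt–Scholze 5.6.2), the
`R`-linear tower being the `lim` of the étale levels by construction (Milne V 1.11 + VI 2.8;
Deligne, Weil I (1.3) for `ℚ_ℓ`). [cite: Milne2025, VI Cor. 2.8 and V Lemma 1.11] -/
theorem module_finite_etaleEllAdicTowerCohomology_of_fact (h₂ : finite_etaleCohomology_of_isProper.{u})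
    {K : Type u} [Field K] [IsSepClosed K] (f : Y ⟶ Spec (.of K)) [IsProper f] :
    Module.Finite ℤ_[ℓ] (etaleEllAdicTowerCohomology Y ℓ i) :=
  module_finite_etaleEllAdicTowerCohomology_of_finite Y ℓ i fun m =>
    haveI : Finite (zmodPowAb.{u} ℓ m) := finite_zmodPowAb.{u} ℓ m hℓ.out.ne_zero
    h₂ K Y f (zmodPowAb.{u} ℓ m) i

/-- `Hⁱ(Y_ét, ℚ_ℓ)` is finite-dimensional for `Y` proper over a separably closed field, from
Milne VI Cor. 2.8 (hypothesis `h₂`). [cite: Milne2025, VI Cor. 2.8] [cite: Deligne1974, (1.3) (p. 274)] -/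
theorem module_finite_etaleEllAdicRat_of_fact (h₂ : finite_etaleCohomology_of_isProper.{u})
    {K : Type u} [Field K] [IsSepClosed K] (f : Y ⟶ Spec (.of K)) [IsProper f] :
    Module.Finite ℚ_[ℓ] (etaleEllAdicRat ℓ Y i) := by
  haveI := module_finite_etaleEllAdicTowerCohomology_of_fact Y ℓ i h₂ f
  infer_instance

end Tower

/-! ### The finiteness axiom (A) of a Weil cohomology for `X ↦ Hⁱ((X_{k̄})_ét, ℚ_ℓ)` -/

section Weil

variable {k : Type u} [Field k] (ℓ : ℕ) [hℓ : Fact ℓ.Prime] (i : ℕ)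

/-- The geometric fibre of a proper `k`-scheme is proper over `k̄` (base change). [folklore] -/
instance isProper_geometricFibre_snd (X : SchemeOver k) [IsProper X.hom] :
    IsProper (pullback.snd X.hom
      (Spec.map (CommRingCat.ofHom (algebraMap k (AlgebraicClosure k))))) :=
  inferInstance

/-- **Axiom (A), finiteness, for the `ℓ`-adic theory `X ↦ Hⁱ((X_{k̄})_ét, ℚ_ℓ)`**
(`ellAdicCohomologyFunctor k ℓ i`, `EllAdicCohomologyFunctorOver.lean`) **on proper `k`-schemes,
from Milne VI Cor. 2.8** (the named fact `finite_etaleCohomology_of_isProper`, hypothesis `h₂`):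
`Hⁱ((X_{k̄})_ét, ℚ_ℓ)` is a finite-dimensional `ℚ_ℓ`-vector space (Deligne, Weil I (1.3):
"Les `Hⁱ(X, ℚ_ℓ)` sont des espaces vectoriels de dimension finie sur `ℚ_ℓ`, nuls pour
`i > 2 dim(X)`", p. 274).
[cite: Deligne1974, (1.3) (p. 274)] [cite: Milne2025, VI Cor. 2.8 and V Lemma 1.11] -/
theorem module_finite_ellAdicCohomologyFunctor_obj_of_fact
    (h₂ : finite_etaleCohomology_of_isProper.{u}) (X : SchemeOver k) [IsProper X.hom] :
    Module.Finite ℚ_[ℓ] ((ellAdicCohomologyFunctor k ℓ i).obj (op X)) :=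
  module_finite_etaleEllAdicRat_of_fact (geometricFibre k X) ℓ i h₂
    (pullback.snd X.hom (Spec.map (CommRingCat.ofHom (algebraMap k (AlgebraicClosure k)))))

/-- **Axiom (A), finiteness, on smooth projective varieties** (the quantifier shape of
`WeilCohomology.finite_obj`), from Milne VI Cor. 2.8 (hypothesis `h₂`).
[cite: Deligne1974, (1.3) (p. 274)] [cite: Milne2025, VI Cor. 2.8] -/
theorem module_finite_ellAdicCohomologyFunctor_obj_of_isSmoothProjective
    (h₂ : finite_etaleCohomology_of_isProper.{u}) ⦃n : ℕ⦄ ⦃X : SchemeOver k⦄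
    (hX : IsSmoothProjective n X) :
    Module.Finite ℚ_[ℓ] ((ellAdicCohomologyFunctor k ℓ i).obj (op X)) := by
  haveI : IsProper X.hom := IsSmoothProjective.isProper_holds hX
  exact module_finite_ellAdicCohomologyFunctor_obj_of_fact ℓ i h₂ X

/-! #### Vanishing above `2 dim X` from Milne VI Thm. 1.1 (hypothesis `h₁`) -/

/-- A tensor product with a trivial module is trivial. [folklore] -/
theorem subsingleton_tensorProduct_of_subsingleton (R : Type*) [CommRing R] (M N : Type*)
    [AddCommGroup M] [Module R M] [AddCommGroup N] [Module R N] [Subsingleton N] :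
    Subsingleton (TensorProduct R M N) := by
  refine subsingleton_of_forall_eq 0 fun x => ?_
  induction x using TensorProduct.induction_on with
  | zero => rfl
  | tmul a b => rw [Subsingleton.elim b 0, TensorProduct.tmul_zero]
  | add a b ha hb => rw [ha, hb, add_zero]

/-- **`Hⁱ((X_{k̄})_ét, ℚ_ℓ) = 0` for `i > 2 dim X`, for the `R`-linear theory, from Milne VI
Thm. 1.1** — "`cd_ℓ(Y_et) ≤ 2 dim Y` for `Y` of finite type over a separably closed field",
taken as the hypothesis `h₁` in the vendored form of `EllAdicComparison.lean` (it is not a named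
fact of the tree): the levels `Hⁱ((X_{k̄})_ét, ℤ/ℓᵐ)` vanish (`h₁`, `dim X_{k̄} = n`), hence their
`lim` (`subsingleton_towerLim`), hence the `R`-linear tower (tower isomorphism
`etaleEllAdicTowerCohomologyAbEquiv`) and `ℚ_ℓ ⊗ lim`. The axiom `Hⁱ(X) = 0, i > 2n` of a Weil
cohomology (`WeilCohomology.subsingleton_obj`) for `ellAdicCohomologyFunctor k ℓ i`; unlike the
pro-étale groups (`subsingleton_geometricEllAdicCohomology_of_lt_of_cd_of_comparison`), no
`lim¹` term and no Bhatt–Scholze comparison intervene. [cite: Milne2025, VI Thm. 1.1]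
[cite: Deligne1974, (1.3) (p. 274)] -/
theorem subsingleton_ellAdicCohomologyFunctor_obj_of_cd
    (h₁ : ∀ (K : Type u) [Field K] [IsSepClosed K] (Y : Scheme.{u}) (f : Y ⟶ Spec (.of K))
      [LocallyOfFiniteType f] [QuasiCompact f] (d : ℕ), topologicalKrullDim Y ≤ d →
      ∀ (ℓ : ℕ) [Fact ℓ.Prime] (F : Sheaf Y.smallEtaleTopology Ab.{u}) (r : ℕ), ℓ ^ r • 𝟙 F = 0 →
      ∀ ⦃i : ℕ⦄, 2 * d < i → Subsingleton (F.H i : Type u))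
    {n : ℕ} {X : SchemeOver k} (hX : IsSmoothProjective n X) {i : ℕ} (hi : 2 * n < i) :
    Subsingleton ((ellAdicCohomologyFunctor k ℓ i).obj (op X)) := by
  have hY : IsSmoothProjective n ((baseChange k (AlgebraicClosure k)).obj X) :=
    hX.baseChange_obj (AlgebraicClosure k)
  haveI := hY.smoothOfRelativeDimension
  haveI : IsProper ((baseChange k (AlgebraicClosure k)).obj X).hom :=
    IsSmoothProjective.isProper_holds hY
  haveI := hY.geometricallyIrreducible
  haveI : IrreducibleSpace ((baseChange k (AlgebraicClosure k)).obj X).left :=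
    GeometricallyIrreducible.irreducibleSpace_of_subsingleton
      ((baseChange k (AlgebraicClosure k)).obj X).hom
  have hdim : topologicalKrullDim ↥((baseChange k (AlgebraicClosure k)).obj X).left ≤ n :=
    (topologicalKrullDim_eq_of_smoothOfRelativeDimension
      ((baseChange k (AlgebraicClosure k)).obj X).hom n).le
  haveI : ∀ m, Subsingleton (etaleCohomologyZModPow (geometricFibre k X) ℓ i m) := fun m =>
    h₁ (AlgebraicClosure k) _ ((baseChange k (AlgebraicClosure k)).obj X).hom n hdim ℓ _ m
      (nsmul_id_constantSheaf_zmodPowAb _ ℓ m) hi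
  haveI := subsingleton_towerLim (etaleCohomologyZModPowMap (geometricFibre k X) ℓ i)
  haveI : Subsingleton (etaleEllAdicTowerCohomology (geometricFibre k X) ℓ i) :=
    (etaleEllAdicTowerCohomologyAbEquiv (geometricFibre k X) ℓ i).toEquiv.subsingleton
  exact subsingleton_tensorProduct_of_subsingleton ℤ_[ℓ] ℚ_[ℓ]
    (etaleEllAdicTowerCohomology (geometricFibre k X) ℓ i)

end Weil

end Literature.AlgebraicGeometry.Motives

end
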